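/-
Copyright (c) 2026 the pub-hodgecm-mathlib formalisation cell (harness21).  Prover seat hodgecm-mathlib-K2E1-p08 (g2), Track B ∕ K2-LIT
(build stream 29), h413 = `stmt-HodgeConjecture-24833`, line `K2_E1_TraceFormulaBeta`; BY-NAME DEAL #7 of the dealer K2E1-plan (g0)
2026-09-03T23:40:37Z: `Theorems/K2E1HeisenbergRadicalCocompactU3.lean` (the `N = 3` twin of ★ p855616 `K2E1SiegelRadicalCocompactU2`).
-/
import Summits.HodgeConjecture.HodgeConjecture.Theorems.K2E1PoincareSeriesCuspidalGlueU2     -- ★ p855468 §3 `finiteCovolume_of_isCompact` (+ ★ rung 1: countability of `G(K)`)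
import Summits.HodgeConjecture.HodgeConjecture.Theorems.K2E1CuspidalSpectrumUnitaryDefsR     -- ★ p855423 `flagUnipotentRadical`, `cmUnipotentRadicalR`, `cmParabolicDataR`
import Literature.NumberTheory.Automorphic.UnitaryGroupHeisenbergFundamentalDomain           -- ★ `heisFundamentalDomain`: `existsUnique_smul_mem_…`, `exists_isCompact_…_subset` (`N(𝔸_F) ≅ 𝔸_E × 𝔸_E⁻`)
import Literature.NumberTheory.Automorphic.LocalUnitaryGroupCongr                            -- ★ `antidiagOne_eq_over` (`Φ₃ = (StdForm.antidiagonal 3).over L`)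
import HarnessLib

/-!
# The Heisenberg radical of `U(Φ₃)`: `N(L⁺)` is cocompact in `N(𝔸_{L⁺})`, so its fundamental domains have finite Haar measure
# (the `N = 3` twin of ★ p855616; (B) of the 5R ∕ cuspidality chain at `𝔓 := cmParabolicDataR L 3`)

Track B ∕ K2-LIT, crux h413 = `stmt-HodgeConjecture-24833`, route of record `HCCMUnconditional`; cell `hodgecm-mathlib`, squad K2; prover seat
`hodgecm-mathlib-K2E1-p08` (g2), BY-NAME DEAL #7 of the dealer K2E1-plan (g0) 2026-09-03T23:40:37Z; lane `--supports stmt-HodgeConjecture-24833 --as helper`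
(count-neutral).  THEOREMS ONLY (no `def`, no `instance`, no notation, no named-fact hypothesis, no `sorry`).

For the quasi-split unitary group `U(Φ₃)` in three variables attached to the CM extension `L/L⁺` (`Φ₃` antidiagonal) the unipotent radical of the (Borel = unique proper
standard) parabolic `P_1` is the HEISENBERG group `N = {[[1, x, z], [0, 1, −x̄], [0, 0, 1]] : z + z̄ + x x̄ = 0}` — in the route's spelling ★ p855423 `cmUnipotentRadicalR L 3 1 =
U(Φ₃)(𝔸_{L⁺}) ∩ R_u(P^{GL}_{(1,1,1)})(𝔸_L)` with `R_u(P_{(1,1,1)}) = N_1 · N_2 = flagUnipotentRadical 3 1`, in the tree's Literature spelling ★ `adelicUnipotent L⁺ L c̄ 3 =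
U(J₃)(𝔸) ∩ (upper unitriangular)`.  §1 identifies the two (`GL₃`: the upper unitriangular matrices ARE `N_2 · N_1`, an explicit factorisation
`[[1,a,b],[0,1,c],[0,0,1]] = (1 + c E₁₂)(1 + a E₀₁ + b E₀₂)` — the membership description listed as open by K2E1-p02 (g0)); §2 carries the tree's COMPACT FUNDAMENTAL SET for
`N(L⁺)` in `N(𝔸_{L⁺})` — ★ `UnitaryGroupHeisenbergFundamentalDomain.heisFundamentalDomain = heisChart (D_L × 𝓕⁻)` (two-step: Tate's `𝔸_L = L + D_L` for the `x`-coordinate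
`N∕Z(N) ≅ 𝔸_L`, and `𝔸_L⁻ = L⁻ + 𝓕⁻` for the centre `Z(N) ≅ {z : z + z̄ = 0}`, ★ `existsUnique_smul_mem_heisFundamentalDomain`, contained in a compact set ★
`exists_isCompact_heisFundamentalDomain_subset`) — over to the route's spelling by `subst` (`Φ₃` vs `(StdForm.antidiagonal 3).over L`, ★ `antidiagOne_eq_over`; §1); §3 concludes,
with ★ p855468 §3 `finiteCovolume_of_isCompact`, that every fundamental domain of `N(L⁺)` in `(N(𝔸_{L⁺}), ν)`, `ν` Haar, has FINITE measure — hypothesis (B) of the cuspidality ∕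
Poincaré-series chain (★ p855440 ∕ ★ p855563-shape) at `𝔓 := cmParabolicDataR L 3` (its only index is `k = 1`).
[CasselsFrohlichANT1967 Ch. XV (Tate) Thm. 4.1.3; BorelJacquet1979 §4.4; Rogawski1990 §1.10 p. 9 («`B = MN`»), §2.1; GelfandGraevPiatetskiShapiro1969 Ch. 1 §4.]

## Contents
* §1 `standardUnipotentRadical_le_upperUnitriangular` (any `n, k`), **`upperUnitriangular_eq_flagUnipotentRadical_three`**: in `GL₃(R)` the upper unitriangular matrices ARE
  `R_u(P_{(1,1,1)}) = N_1 · N_2` (★ `flagUnipotentRadical 3 1`).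
* §2 `exists_isCompact_rational_smul_mem_of_eq_three`, `exists_isCompact_rational_smul_mem_heisenberg`: a compact `C ⊆ N(𝔸)` with `N(K) • C = N(𝔸)`, for any subgroup EQUAL to
  `adelicUnipotent F E c 3` and for any form EQUAL to `(StdForm.antidiagonal 3).over L`.
* §3 `countable_rational_cmParabolicDataR_three`, **`finiteCovolume_cmParabolicDataR_three`** (= (B) at `N = 3`, binder for binder as in ★ p855616).
CONSUMERS: K2E1-p09 (g2) `ReductionTheoryU3` (the `Ω`-factor of the Siegel set), K2E1-p04 (g2) (10) (local filtration ★ p855711 — different currency: local `unipotentU`), a future 5R at `N = 3`.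

HONEST LABEL: HC_CM is proved only modulo the 7 printed citations (2 remaining named inputs: hLiu418 = `stmt-HodgeConjecture-24832`, h413 = `stmt-HodgeConjecture-24833`)
until rung 0 closes; this file moves no counter and closes no socket.
-/

set_option autoImplicit false
-- the mandated namespace repeats the single-problem summit's segment (`HodgeConjecture.HodgeConjecture`)
set_option linter.dupNamespace false

open MeasureTheory Filter Topology NumberField IsDedekindDomain
open scoped ENNReal Pointwise MatrixGroups
open Literature.NumberTheory.Automorphic Literature.NumberTheory.Automorphic.UnitaryGroup
open Literature.NumberTheory.Automorphic.AdelicGroupData.ParabolicUnipotentData (coe_mem_quotientSubgroup_of_mem_rational)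
open Summit.HodgeConjecture.HodgeConjecture.Cruxes.H413.K2E1PoincareSeriesCompactSupport (countable_quotientSubgroup_of_center'_eq_bot)
open Summit.HodgeConjecture.HodgeConjecture.Cruxes.H413.K2E1PoincareSeriesCuspidalGlueU2 (finiteCovolume_of_isCompact)
open Summit.HodgeConjecture.HodgeConjecture.Cruxes.H413.K2E1CuspidalSpectrumUnitary (flagUnipotentRadical cmUnipotentRadicalR cmParabolicDataR)

namespace Summit.HodgeConjecture.HodgeConjecture.Cruxes.H413.K2E1HeisenbergRadicalCocompactU3

/-! ## §1 Upper unitriangular `3 × 3` matrices are `N_2 · N_1 = R_u(P_{(1,1,1)})` -/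

section Unitriangular

/-- **`N_k = 1 + 𝔫_k` consists of upper unitriangular matrices** (any `n`, `k`): the block `i < k ≤ j` lies strictly above the diagonal. [cite: BorelJacquet1979, §4.4] -/
theorem standardUnipotentRadical_le_upperUnitriangular (n k : ℕ) (R : Type*) [CommRing R] :
    standardUnipotentRadical n k R ≤ upperUnitriangular (Fin n) R := by
  rintro _ ⟨X, rfl⟩
  rw [mem_upperUnitriangular_iff]
  refine ⟨?_, fun i => ?_⟩
  · intro i j hji
    have hji' : j.val < i.val := Fin.lt_def.1 hji
    rw [coe_unipotentOfBlock, Matrix.add_apply, Matrix.one_apply_ne (Fin.lt_def.2 hji').ne',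
      apply_eq_zero_of_mem_blockNilpotent X.toAdd.2 (fun h => by omega), zero_add]
  · rw [coe_unipotentOfBlock, Matrix.add_apply, Matrix.one_apply_eq, apply_eq_zero_of_mem_blockNilpotent X.toAdd.2 (fun h => by omega), add_zero]

/-- **In `GL₃(R)` the upper unitriangular subgroup (the Heisenberg group) equals `R_u(P_{(1,1,1)}) = N_1 ⊔ N_2`** (★ `flagUnipotentRadical 3 1`): `⊇` since both `N_k` are upper
unitriangular; `⊆` by the explicit factorisation `[[1,a,b],[0,1,c],[0,0,1]] = (1 + c E₁₂) · (1 + a E₀₁ + b E₀₂)`, `1 + c E₁₂ ∈ N_2`, `1 + a E₀₁ + b E₀₂ ∈ N_1`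
(★ `unipotentOfBlock_mul_mem_flagUnipotentRadical`).  The membership description of the route's Heisenberg radical ★ `cmUnipotentRadicalR L 3 1`.
[cite: Borel1991, Prop. 14.21] [cite: BorelJacquet1979, §4.4] [cite: Rogawski1990, §1.10 p. 9] -/
theorem upperUnitriangular_eq_flagUnipotentRadical_three (R : Type*) [CommRing R] :
    upperUnitriangular (Fin 3) R = flagUnipotentRadical 3 1 R := by
  refine le_antisymm (fun g hg => ?_) (sup_le (standardUnipotentRadical_le_upperUnitriangular 3 1 R) (standardUnipotentRadical_le_upperUnitriangular 3 (3 - 1) R))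
  obtain ⟨htri, hdiag⟩ := (mem_upperUnitriangular_iff g).1 hg
  have h10 : (g : Matrix (Fin 3) (Fin 3) R) 1 0 = 0 := htri (by decide)
  have h20 : (g : Matrix (Fin 3) (Fin 3) R) 2 0 = 0 := htri (by decide)
  have h21 : (g : Matrix (Fin 3) (Fin 3) R) 2 1 = 0 := htri (by decide)
  -- `X₁ = a E₀₁ + b E₀₂ ∈ 𝔫_1`, `X₂ = c E₁₂ ∈ 𝔫_2`
  have hX₁ : (Matrix.of fun i j : Fin 3 => if i = 0 ∧ j = 1 then (g : Matrix (Fin 3) (Fin 3) R) 0 1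
      else if i = 0 ∧ j = 2 then (g : Matrix (Fin 3) (Fin 3) R) 0 2 else 0) ∈ blockNilpotent 3 1 R := by
    intro i j h
    simp only [Matrix.of_apply] at h
    split_ifs at h with h₁ h₂
    · obtain ⟨rfl, rfl⟩ := h₁; decide
    · obtain ⟨rfl, rfl⟩ := h₂; decide
    · exact absurd rfl h
  have hX₂ : (Matrix.of fun i j : Fin 3 => if i = 1 ∧ j = 2 then (g : Matrix (Fin 3) (Fin 3) R) 1 2 else 0) ∈ blockNilpotent 3 (3 - 1) R := by
    intro i j h
    simp only [Matrix.of_apply] at h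
    split_ifs at h with h₁
    · obtain ⟨rfl, rfl⟩ := h₁; decide
    · exact absurd rfl h
  have hfac : g = unipotentOfBlock 3 (3 - 1) R (Multiplicative.ofAdd ⟨_, hX₂⟩) * unipotentOfBlock 3 1 R (Multiplicative.ofAdd ⟨_, hX₁⟩) := by
    refine Units.ext ?_
    rw [Units.val_mul, coe_unipotentOfBlock, coe_unipotentOfBlock]
    ext i j
    fin_cases i <;> fin_cases j <;>
      simp [Matrix.mul_apply, Fin.sum_univ_three, Matrix.one_apply, h10, h20, h21, hdiag]
  rw [hfac]
  exact K2E1CuspidalSpectrumUnitary.unipotentOfBlock_mul_mem_flagUnipotentRadical 3 1 R _ _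

end Unitriangular

/-! ## §2 A compact fundamental set for `N(K)` in the Heisenberg group `N(𝔸)` -/

section Quasisplit

variable {F E : Type} [Field F] [NumberField F] [Field E] [NumberField E] [Algebra F E] {c : E ≃ₐ[F] E}

/-- **`N(F) • C = N(𝔸_F)` for a compact `C`, for the Heisenberg radical of `U(J₃)`** (`c² = 1`): `C ⊇ 𝓕_N = heisChart (D_E × 𝓕⁻)`, the tree's fundamental domain (★
`existsUnique_smul_mem_heisFundamentalDomain`: unique `x₀ ∈ E` by Tate for `E ⊂ 𝔸_E`, then unique `y₀ ∈ E⁻` for the centre; ★ `exists_isCompact_heisFundamentalDomain_subset`);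
stated for every subgroup `Nsub` EQUAL to `adelicUnipotent F E c 3`, with its rational points `G(F) ∩ Nsub`. [cite: CasselsFrohlichANT1967, Ch. XV Thm. 4.1.3] [cite: Rogawski1990, §2.1] -/
theorem exists_isCompact_rational_smul_mem_of_eq_three (hc : c * c = 1) {Nsub : Subgroup (quasiSplit F E c 3).Adelic} (hN : Nsub = adelicUnipotent F E c 3) :
    ∃ C : Set ↥Nsub, IsCompact C ∧ ∀ u : ↥Nsub, ∃ l : ↥(((quasiSplit F E c 3).arithmeticSubgroup).comap Nsub.subtype), l • u ∈ C := by
  subst hN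
  obtain ⟨C, hC, hsub⟩ := exists_isCompact_heisFundamentalDomain_subset (F := F) (E := E) (c := c) hc
  refine ⟨C, hC, fun u => ?_⟩
  obtain ⟨γ, hγ, -⟩ := existsUnique_smul_mem_heisFundamentalDomain (F := F) (E := E) (c := c) hc u
  exact ⟨γ, hsub hγ⟩

end Quasisplit

section CM

variable (L : Type) [Field L] [NumberField L] [IsCMField L]

/-- **`N(L⁺) • C = N(𝔸_{L⁺})` for a compact `C`, for the Heisenberg radical `U(J) ∩ R_u(P_{(1,1,1)})` of `U(J)`, `J` ANY matrix equal to `(StdForm.antidiagonal 3).over L`** (in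
particular the route's `Φ₃`, ★ `antidiagOne_eq_over`): §2 for `Nsub := (R_u(P_{(1,1,1)})(𝔸_L)).comap adelicVal = adelicUnipotent` (§1), transported along `J = J'` by substitution.
[cite: CasselsFrohlichANT1967, Ch. XV Thm. 4.1.3] [cite: BorelJacquet1979, §4.4] [cite: Rogawski1990, §2.1] -/
theorem exists_isCompact_rational_smul_mem_heisenberg {J : Matrix (Fin 3) (Fin 3) L} (hJ : (StdForm.antidiagonal 3).over L = J) :
    ∃ C : Set ↥((flagUnipotentRadical 3 1 (AdeleRing (𝓞 L) L)).comap
        (adelicVal (↥(maximalRealSubfield L)) L (IsCMField.complexConj L) 3 J)), IsCompact C ∧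
      ∀ u, ∃ l : ↥(((adelicGroupData (↥(maximalRealSubfield L)) L (IsCMField.complexConj L) 3 J).arithmeticSubgroup).comap
        ((flagUnipotentRadical 3 1 (AdeleRing (𝓞 L) L)).comap (adelicVal (↥(maximalRealSubfield L)) L (IsCMField.complexConj L) 3 J)).subtype), l • u ∈ C := by
  subst hJ
  -- `c² = 1` (★ `IsCMField.orderOf_complexConj`)
  exact exists_isCompact_rational_smul_mem_of_eq_three (by rw [← pow_two, ← IsCMField.orderOf_complexConj L, pow_orderOf_eq_one])
    (congrArg (Subgroup.comap (adelicVal (↥(maximalRealSubfield L)) L (IsCMField.complexConj L) 3 ((StdForm.antidiagonal 3).over L)))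
      (upperUnitriangular_eq_flagUnipotentRadical_three (AdeleRing (𝓞 L) L)).symm)

/-! ## §3 (B) at `𝔓 := cmParabolicDataR L 3`: fundamental domains of `N(L⁺)` in `N(𝔸_{L⁺})` have finite Haar measure -/

/-- `N_1(L⁺)` is countable (it injects into `U(Φ₃)(L⁺)`, countable by ★ rung 1). [cite: BorelJacquet1979, §4.4] -/
theorem countable_rational_cmParabolicDataR_three (i : (cmParabolicDataR L 3).ι) : Countable ((cmParabolicDataR L 3).rational i) := by
  haveI := countable_quotientSubgroup_of_center'_eq_bot (cmDatum L 3 (Matrix.of fun i j : Fin 3 => if i.val + j.val + 1 = 3 then (1 : L) else 0)) rfl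
    (cmDatum_isDiscreteRational L 3 _)
  exact Function.Injective.countable
    (f := fun l : (cmParabolicDataR L 3).rational i =>
      (⟨((l : (cmParabolicDataR L 3).radical i) : (cmDatum L 3 (Matrix.of fun i j : Fin 3 => if i.val + j.val + 1 = 3 then (1 : L) else 0)).Adelic),
        coe_mem_quotientSubgroup_of_mem_rational (cmParabolicDataR L 3) l.2⟩ :
        (cmDatum L 3 (Matrix.of fun i j : Fin 3 => if i.val + j.val + 1 = 3 then (1 : L) else 0)).quotientSubgroup))
    fun a b h => Subtype.ext (Subtype.ext (congrArg Subtype.val h :))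

/-- **(B) AT `N = 3`: FUNDAMENTAL DOMAINS OF THE HEISENBERG `N(L⁺)` IN `N(𝔸_{L⁺})` HAVE FINITE HAAR MEASURE.**  For the route's repaired parabolic data `cmParabolicDataR L 3` (★ p855423; one
index `k = 1`, the Heisenberg radical `cmUnipotentRadicalR L 3 1`), every Haar measure `ν` on `↥N(𝔸_{L⁺})` and every fundamental domain `𝓕` of the left action of `N(L⁺)`: `ν 𝓕 < ∞` —
by ★ p855468 §3 `finiteCovolume_of_isCompact` and the compact fundamental set of §2.  The shape of hypothesis `hB` of ★ `K2E1GlobaliseSupercuspidalU2Poincare.globaliseSupercuspidal_of_poincare`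
∕ (B) of ★ p855440, read at `N = 3`. [cite: CasselsFrohlichANT1967, Ch. XV Thm. 4.1.3] [cite: BorelJacquet1979, §4.4] [cite: GelfandGraevPiatetskiShapiro1969, Ch. 1 §4] -/
theorem finiteCovolume_cmParabolicDataR_three (i : (cmParabolicDataR L 3).ι) [MeasurableSpace ((cmParabolicDataR L 3).radical i)]
    [BorelSpace ((cmParabolicDataR L 3).radical i)] (νN : Measure ((cmParabolicDataR L 3).radical i)) [νN.IsHaarMeasure]
    (𝓕 : Set ((cmParabolicDataR L 3).radical i)) (h𝓕 : IsFundamentalDomain ((cmParabolicDataR L 3).rational i) 𝓕 νN) : νN 𝓕 < ∞ := by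
  haveI := countable_rational_cmParabolicDataR_three L i
  obtain ⟨k, hk⟩ := i
  obtain rfl : k = 1 := by omega
  obtain ⟨C, hC, hcov⟩ :
      ∃ C : Set ↥((cmParabolicDataR L 3).radical ⟨1, hk⟩), IsCompact C ∧
        ∀ u : ↥((cmParabolicDataR L 3).radical ⟨1, hk⟩), ∃ l : (cmParabolicDataR L 3).rational ⟨1, hk⟩, l • u ∈ C :=
    exists_isCompact_rational_smul_mem_heisenberg L (antidiagOne_eq_over (L := L) (N := 3)).symm
  exact finiteCovolume_of_isCompact (cmParabolicDataR L 3) ⟨1, hk⟩ C hC hcov νN 𝓕 h𝓕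

end CM

end Summit.HodgeConjecture.HodgeConjecture.Cruxes.H413.K2E1HeisenbergRadicalCocompactU3
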